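import Summits.BirchSwinnertonDyer.Rank1Residual.Additive.LocalReductionIndex
import Literature.NumberTheory.EllipticCurves.PadicPointsHomFiltrationProofs
import HarnessLib

/-!
# The image of the `p`-adic logarithm on `E(ℚ_p)`: `log(E(ℚ_p)) = p^{1 + t − ord_p(c_p · #Ẽ_ns(𝔽_p))} ℤ_p`
# for every reduction type, and `log(E(ℚ_p)) = p^{t − ord_p c_p} ℤ_p` at an ADDITIVE prime — the
# POINTS SIDE of the local index `exp*_ω(H¹_s(ℚ_p, T)) = p^{ord_p c_p − t} ℤ_p` (cell `b2b-bsdres`,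
# team n1011, row T-R1-24 = ROUTE-1 §20.8 R1-24 / §20.2 (I2); seat n1011-p05 gen 3)

HONEST FRAMING (cell `b2b-bsdres`, run/shared/lean/b2b/bsd-rank1-residual/, verbatim in every
file): the goal of the cell is to DELETE the COMBINATION-SHAPED residual classes of the
Birch–Swinnerton-Dyer formula for ALL analytic-rank `≤ 1` elliptic curves over `ℚ` — "full BSD
formula for every rank `≤ 1` curve in class `C`" assembled STRICTLY from published theorems — so
that the rank-`≤ 1` remainder becomes exactly the CONSTRUCTION-SHAPED classes, which are TYPED
(missing-input `Prop`s), NOT attempted. This is not "finishing BSD". Team n1011 (X4 ∧ `p = 3`,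
§I N10/N11; ROUTE-1 (a′) of planner r1): research route; TOOL theorems on local points, no class
theorem; ONE definition with a body (`padicLog`, the `ℚ_p`-valued logarithm on all of `E(ℚ_p)`),
no named fact; nothing booked; no label changes.

## What and why

Planner r1's ledger (ROUTE-1 §20.2) at an additive prime uses the LOCAL INDEX
(I2) `exp*_{ω_E}(H¹_s(ℚ₃, T)) = 3^{ord₃ c₃ − e} ℤ₃` (`H¹_s = H¹/H¹_f`, `e = length E(ℚ₃)[3^∞]`), of
which C.-H. Kim, AJM 148 (2026), Lemma 3.10 (`= p^{−t} ℤ_p` at an additive `p ≥ 3`) is the case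
`3 ∤ c₃` and §17 F-b of the route (`c₃ = 3` at Kodaira IV/IV*) the correction.  (I2) has two halves:

* the POINTS SIDE `log_ω(E(ℚ_p)) = p^{t − ord_p c_p} ℤ_p` — a statement about `E(ℚ_p)`, the formal
  group and the Kodaira–Néron index only.  THIS FILE PROVES IT, for every prime `p` (no parity
  hypothesis: the level `E⁽²⁾(ℚ_p) ≅ p²ℤ_p` is used, not `E₁ ≅ pℤ_p`), with NO hypothesis on
  `E(ℚ_p)[p]` (`t` is an output) or on `c_p`, in the general form
  **`log(E(ℚ_p)) = p^{1 + t − ord_p c_p − ord_p #Ẽ_ns(𝔽_p)} ℤ_p` valid for EVERY reduction type**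
  — the `ℤ_p`-dual of Kim's display (§3.2.3, before Thm. 3.7, PDF p. 16) "`exp*_{ω_E} :
  H¹(ℚ_p, T)/E(ℚ_p) ⊗ ℤ_p ≅ (#Ẽ_ns(𝔽_p) · [E(ℚ_p):E₀(ℚ_p)])/(#H⁰(ℚ_p, E[p^∞])) · (1/p) · ℤ_p`";
* the GALOIS SIDE (`H¹_f(ℚ_p, T_pE) = E(ℚ_p) ⊗ ℤ_p`, Bloch–Kato Example 3.11; local Tate duality in
  the form `⟨x, y⟩ = exp*_ω(x) · log_ω(y)`, Kato, Astérisque 295, proof of Lemma 14.18 via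
  [Bloch–Kato, Prop. 3.8]) — published `p`-adic Hodge theory for which the tree has no object yet
  (`BlochKatoFiniteSubgroupCompact` has `H¹_f`, `H¹_s`, `loc^s` for lattices but no `exp*`); NOT
  proved here, it stays inside the typed DICT3 statement of ROUTE-1 R1-21 (the same located gap as
  "derivation step D1" of lit-kato's `Kato2004/LocalIndexSkeletonProofs`).

For a `p`-integral elliptic `X/ℚ_p` let `L = padicLimitLog` be the tree's limit logarithm
(`lim z(pᵏQ)/pᵏ`; an isomorphism `E⁽²⁾(ℚ_p) ≅ p²ℤ_p`, Silverman *AEC* IV.6.4, VII.6.3) and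
`N = [E(ℚ_p) : E⁽²⁾(ℚ_p)]` (finite).  The def-free bookkeeping (`N = c_p · #Ẽ_ns(𝔽_p) · p`,
`#Ẽ_ns(𝔽_p) = p` at additive reduction, `#E(ℚ_p)[p^∞] = p^t` with `t := v_p #E(ℚ_p)_tors`) is the
sibling `Additive/LocalReductionIndex.lean`; the WITH-TORSION `ℤ_p`-line `Ψ(E(ℚ_p)) = p^t ℤ_p` is
x11b gen 17's `ZpLineIndexTorsion.range_psi_eq_span_pow` (multr1-p2), imported BY NAME.  Contents:

* §2 `padicLog X : E(ℚ_p) →+ ℚ_p`, `log(P) = L(N • P)/N` — the unique homomorphism extending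
  `L|_{E⁽²⁾}` (`padicLog_apply_of_mem`, `eq_padicLog_of_forall_mem`), i.e. the `ℤ_p`-linear extension
  `log_ω` of Kato / Kim / Castella–JSW; `padicLog_eq_psi` (`log = (p²/N) · Ψ` for x11b's coordinate `Ψ`);
  `padicLog_eq_zero_iff` / `ker_padicLog` (**kernel = torsion**);
  **`range_padicLog_eq_span_zpow`: `log(E(ℚ_p)) = p^{2 + t − v_p N} ℤ_p`**.
* §3 minimal `X`: **`range_padicLog_eq_span_zpow_of_isMinimal`:
  `log(E(ℚ_p)) = p^{1 + t − v_p c_p − v_p #Ẽ_ns(𝔽_p)} ℤ_p`** (ANY reduction type); ADDITIVE `X`: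
  **`range_padicLog_eq_span_zpow_of_hasAdditiveReduction`: `log(E(ℚ_p)) = p^{t − v_p c_p} ℤ_p`**
  (= (I2), points side; F-b built in) and `…_of_not_dvd` (Kim's Lemma 3.10 regime `p ∤ c_p`: `p^t ℤ_p`).

PROVISO (referee 1, ACK-1 2026-08-21T10:01Z): every statement in THIS file is about `padicLog`,
i.e. about the tree's LIMIT logarithm `padicLimitLog` (`lim z(pᵏQ)/pᵏ`) rescaled by the index; the
identification `padicLog = log_ω` (limit logarithm = the formal-group logarithm `log_W ∘ z = ∫ω` on
`E⁽²⁾(ℚ_p)`, hence `padicLog P = log_W(z(N • P))/N`) is PROVED ONLY in the sibling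
`Additive/PadicLogFormalGroup.lean` (`padicLimitLog_eq_padicLogPoint_of_mem`,
`padicLog_eq_padicLogPoint_nsmul_div`); until that file is in the tree, read "`log`" below as
"`padicLimitLog`-based logarithm".  The `ℚ`-curve wrapper (`W/ℚ` globally minimal, `Addv W p`, the
cell's predicates) is `Additive/LocalLogImageRat.lean`; the torsion exponent lemmas
(`E(ℚ_p)[p^∞] = E(ℚ_p)[p]` at additive `p ≥ 3`, `p ∤ c_p`) are `Additive/LocalTorsionExponent.lean`.

## References

* [Kim2022StructureSelmer] C.-H. Kim, Amer. J. Math. 148 (2026) = arXiv:2203.12159: §3.2.3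
  (display before Thm. 3.7), Remark 3.8, Lemma 3.10 (PDF pp. 16–17).
* [Kato2004Asterisque] K. Kato, Astérisque 295 (2004), Lemma 14.18 and its proof (pp. 247–248).
* [SilvermanAEC2009] J. H. Silverman, *The Arithmetic of Elliptic Curves*, 2nd ed. (2009): III.2.5
  and Ex. 3.5, IV.3.2, IV.6.4, VII.2.1–2.2, VII.3.1, VII.5.1, VII.6.1, VII.6.3.
-/

noncomputable section

open scoped Classical

namespace Summit.BirchSwinnertonDyer.Rank1Residual.Additive.LocalLog

open Summit.BirchSwinnertonDyer.Rank1Residual.X11b.LocalIndex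

variable {p : ℕ} [Fact p.Prime]

/-! ## §2 The `p`-adic logarithm on ALL of `E(ℚ_p)` and its image -/

section Curve

open WeierstrassCurve

variable (X : WeierstrassCurve ℚ_[p]) [X.IsIntegral ℤ_[p]] [X.IsElliptic]

/-- `p ≠ 0` in `ℚ_p`. [folklore] -/
theorem natCast_p_ne_zero : ((p : ℕ) : ℚ_[p]) ≠ 0 :=
  Nat.cast_ne_zero.mpr (Fact.out : p.Prime).ne_zero

/-- **The `p`-adic logarithm on all of `E(ℚ_p)`**, `ℚ_p`-valued: `log(P) := L(N • P) / N` with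
`N = [E(ℚ_p) : E⁽²⁾(ℚ_p)]` and `L` the tree's limit logarithm `padicLimitLog` (`= lim z(pᵏQ)/pᵏ`,
additive on `E⁽²⁾(ℚ_p)` and an isomorphism `E⁽²⁾(ℚ_p) ≅ p²ℤ_p`, Silverman *AEC* IV.6.4, VII.6.3).
This is the unique homomorphism `E(ℚ_p) → ℚ_p` extending `L|_{E⁽²⁾}` (`ℚ_p` is uniquely
divisible), i.e. the `ℤ_p`-linear extension `log_ω` of the formal-group logarithm used by Kato
(Astérisque 295, proof of Lemma 14.18), Kim (AJM 148 §3.2.3) and Castella / JSW (`log_{ω_E}`) —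
the identification `L = log_W ∘ z` on `E⁽²⁾(ℚ_p)` being PROVED in the sibling
`Additive/PadicLogFormalGroup.lean`, not here (referee-1 proviso). [cite: SilvermanAEC2009, IV.6.4 and VII.6.3] -/
def padicLog : X.toAffine.Point →+ ℚ_[p] where
  toFun P := X.padicLimitLog ((X.formalFiltration 2).index • P) / ((X.formalFiltration 2).index : ℚ_[p])
  map_zero' := by rw [nsmul_zero, X.padicLimitLog_zero, zero_div]
  map_add' P Q := by
    rw [nsmul_add, X.padicLimitLog_add_of_mem le_rfl ((X.formalFiltration 2).nsmul_index_mem P)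
      ((X.formalFiltration 2).nsmul_index_mem Q), add_div]

/-- Unfolding `padicLog`. [folklore] -/
theorem padicLog_apply (P : X.toAffine.Point) :
    padicLog X P = X.padicLimitLog ((X.formalFiltration 2).index • P) /
      ((X.formalFiltration 2).index : ℚ_[p]) := rfl

/-- On `E⁽²⁾(ℚ_p)` the logarithm IS the limit logarithm: `log(P) = L(P)`. [cite: SilvermanAEC2009, VII.6.3] -/
theorem padicLog_apply_of_mem {P : X.toAffine.Point} (hP : P ∈ X.formalFiltration 2) :
    padicLog X P = X.padicLimitLog P := by
  rw [padicLog_apply, X.padicLimitLog_nsmul_of_mem le_rfl hP,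
    mul_div_cancel_left₀ _ (Nat.cast_ne_zero.mpr (index_formalFiltration_two_ne_zero X))]

/-- **Uniqueness**: `padicLog X` is the ONLY homomorphism `E(ℚ_p) → ℚ_p` extending the limit
logarithm on `E⁽²⁾(ℚ_p)` (`ℚ_p` is uniquely divisible and `N • P ∈ E⁽²⁾(ℚ_p)` for every `P`).
[cite: SilvermanAEC2009, VII.6.3] -/
theorem eq_padicLog_of_forall_mem (f : X.toAffine.Point →+ ℚ_[p])
    (hf : ∀ P ∈ X.formalFiltration 2, f P = X.padicLimitLog P) : f = padicLog X := by
  ext P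
  have hN : ((X.formalFiltration 2).index : ℚ_[p]) ≠ 0 :=
    Nat.cast_ne_zero.mpr (index_formalFiltration_two_ne_zero X)
  have h1 : ((X.formalFiltration 2).index : ℚ_[p]) * f P =
      ((X.formalFiltration 2).index : ℚ_[p]) * padicLog X P := by
    rw [← nsmul_eq_mul, ← map_nsmul, hf _ ((X.formalFiltration 2).nsmul_index_mem P), padicLog_apply,
      mul_div_cancel₀ _ hN]
  exact mul_left_cancel₀ hN h1

/-- `log = (p² / N) · Ψ` for the `ℤ_p`-coordinate `Ψ(P) = φ₂(N • P)` of x11b's `ZpLineIndex` along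
`φ₂ : E⁽²⁾(ℚ_p) ≅ ℤ_p`, `φ₂(Q) = L(Q)/p²`. [cite: SilvermanAEC2009, VII.6.3] -/
theorem padicLog_eq_psi (φ₂ : X.formalFiltration 2 ≃+ ℤ_[p])
    (hφ₂ : ∀ P : X.formalFiltration 2, ((φ₂ P : ℤ_[p]) : ℚ_[p]) = X.padicLimitLog P / (p : ℚ_[p]) ^ 2)
    (P : X.toAffine.Point) :
    padicLog X P = (p : ℚ_[p]) ^ 2 / ((X.formalFiltration 2).index : ℚ_[p]) *
      ((psi (X.formalFiltration 2) φ₂ P : ℤ_[p]) : ℚ_[p]) := by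
  rw [psi_apply, hφ₂, padicLog_apply]
  have hp2 : (p : ℚ_[p]) ^ 2 ≠ 0 := pow_ne_zero 2 natCast_p_ne_zero
  symm
  rw [div_mul_div_comm, mul_comm ((p : ℚ_[p]) ^ 2), mul_div_mul_right _ _ hp2]

/-- **`log(P) = 0` iff `P` is a torsion point.** [cite: SilvermanAEC2009, IV.6.4 and VII.6.3] -/
theorem padicLog_eq_zero_iff (P : X.toAffine.Point) : padicLog X P = 0 ↔ IsOfFinAddOrder P := by
  haveI := X.finiteIndex_formalFiltration 2
  obtain ⟨φ₂, hφ₂⟩ := exists_formalFiltration_two_addEquiv X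
  rw [padicLog_eq_psi X φ₂ hφ₂, mul_eq_zero, ← psi_eq_zero_iff (X.formalFiltration 2) φ₂ P]
  have hp2 : (p : ℚ_[p]) ^ 2 ≠ 0 := pow_ne_zero 2 natCast_p_ne_zero
  have hN : ((X.formalFiltration 2).index : ℚ_[p]) ≠ 0 :=
    Nat.cast_ne_zero.mpr (index_formalFiltration_two_ne_zero X)
  constructor
  · rintro (h | h)
    · exact absurd h (div_ne_zero hp2 hN)
    · exact PadicInt.coe_eq_zero.mp h
  · intro h
    exact Or.inr (PadicInt.coe_eq_zero.mpr h)

/-- The kernel of `log` is the torsion subgroup of `E(ℚ_p)`. [cite: SilvermanAEC2009, IV.6.4 and VII.6.3] -/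
theorem ker_padicLog : (padicLog X).ker = AddCommGroup.torsion X.toAffine.Point := by
  ext P
  rw [AddMonoidHom.mem_ker, padicLog_eq_zero_iff]
  rfl

/-- **THE IMAGE OF THE LOGARITHM (integral equation).** For a `p`-integral elliptic `X/ℚ_p`,
`log(E(ℚ_p)) = p^{2 + t − v_p N} ℤ_p` with `p^t` the `p`-part of `#E(ℚ_p)_tors` and
`N = [E(ℚ_p) : E⁽²⁾(ℚ_p)]`: `log = (p²/N)·Ψ` and `Ψ(E(ℚ_p)) = p^t ℤ_p` (x11b `ZpLineIndexTorsion.range_psi_eq_span_pow`,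
`p^t = #E(ℚ_p)[p^∞]`), `N/p^{v_p N} ∈ ℤ_pˣ`.
[cite: SilvermanAEC2009, IV.6.4 and VII.6.3] -/
theorem range_padicLog_eq_span_zpow :
    (padicLog X).range = (Submodule.span ℤ_[p] {(p : ℚ_[p]) ^
      ((2 : ℤ) + padicValNat p (Nat.card (AddCommGroup.torsion X.toAffine.Point)) -
        padicValNat p (X.formalFiltration 2).index)}).toAddSubgroup := by
  haveI := X.finiteIndex_formalFiltration 2
  obtain ⟨φ₂, hφ₂⟩ := exists_formalFiltration_two_addEquiv X
  obtain ⟨i, hrange, hprim⟩ := range_psi_eq_span_pow (X.formalFiltration 2) φ₂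
  have hN0 : (X.formalFiltration 2).index ≠ 0 := index_formalFiltration_two_ne_zero X
  obtain ⟨j, N', hN', hNeq⟩ := Nat.exists_eq_pow_mul_and_not_dvd hN0 p (Fact.out : p.Prime).ne_one
  have ht : padicValNat p (Nat.card (AddCommGroup.torsion X.toAffine.Point)) = i := by
    have h := natCard_primaryComponent_point_eq_pow X
    rw [← hprim] at h
    exact (Nat.pow_right_injective (Fact.out : p.Prime).two_le h).symm
  have hj : padicValNat p (X.formalFiltration 2).index = j := by
    rw [hNeq, mul_comm, padicValNat_mul_pow_eq hN']
  rw [ht, hj]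
  -- `N'` is a unit of `ℤ_p`
  have hu : IsUnit ((N' : ℕ) : ℤ_[p]) := by
    rw [PadicInt.isUnit_iff, PadicInt.norm_natCast_eq_one_iff]
    exact (Nat.Prime.coprime_iff_not_dvd Fact.out).mpr hN'
  obtain ⟨u, hu'⟩ := hu
  have hp0 : (p : ℚ_[p]) ≠ 0 := natCast_p_ne_zero
  have huq : ((u : ℤ_[p]) : ℚ_[p]) ≠ 0 := by
    rw [Ne, PadicInt.coe_eq_zero]; exact u.ne_zero
  have huinv : (((u⁻¹ : ℤ_[p]ˣ) : ℤ_[p]) : ℚ_[p]) = (((u : ℤ_[p]) : ℚ_[p]))⁻¹ :=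
    eq_inv_of_mul_eq_one_left (by rw [← PadicInt.coe_mul, Units.inv_mul, PadicInt.coe_one])
  have hNq : (((X.formalFiltration 2).index : ℕ) : ℚ_[p]) = (p : ℚ_[p]) ^ j * ((u : ℤ_[p]) : ℚ_[p]) := by
    rw [hNeq, hu']; push_cast; rfl
  have hzpow : (p : ℚ_[p]) ^ ((2 : ℤ) + (i : ℕ) - (j : ℕ)) =
      (p : ℚ_[p]) ^ 2 * (p : ℚ_[p]) ^ i / (p : ℚ_[p]) ^ j := by
    rw [zpow_sub₀ hp0, zpow_add₀ hp0, zpow_natCast, zpow_natCast]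
    norm_cast
  -- the key rewriting of a value of `log`
  have key : ∀ z : ℤ_[p], (p : ℚ_[p]) ^ 2 / (((X.formalFiltration 2).index : ℕ) : ℚ_[p]) *
      (((p : ℤ_[p]) ^ i * z : ℤ_[p]) : ℚ_[p]) =
        ((z * ((u⁻¹ : ℤ_[p]ˣ) : ℤ_[p]) : ℤ_[p]) : ℚ_[p]) * (p : ℚ_[p]) ^ ((2 : ℤ) + (i : ℕ) - (j : ℕ)) := by
    intro z
    simp only [PadicInt.coe_mul, PadicInt.coe_pow, PadicInt.coe_natCast]
    rw [huinv, hzpow, hNq]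
    field_simp
  ext y
  rw [Submodule.mem_toAddSubgroup, Submodule.mem_span_singleton]
  constructor
  · rintro ⟨P, rfl⟩
    have hmem : psi (X.formalFiltration 2) φ₂ P ∈ (psi (X.formalFiltration 2) φ₂).range := ⟨P, rfl⟩
    rw [hrange] at hmem
    obtain ⟨z, hz⟩ := (mem_span_pow_iff i _).mp hmem
    refine ⟨z * ((u⁻¹ : ℤ_[p]ˣ) : ℤ_[p]), ?_⟩
    rw [padicLog_eq_psi X φ₂ hφ₂ P, hz, key z, Algebra.smul_def, PadicInt.algebraMap_apply]
  · rintro ⟨c, rfl⟩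
    have hmem : (p : ℤ_[p]) ^ i * (c * (N' : ℤ_[p])) ∈ (psi (X.formalFiltration 2) φ₂).range := by
      rw [hrange]; exact (mem_span_pow_iff i _).mpr ⟨c * (N' : ℤ_[p]), rfl⟩
    obtain ⟨P, hP⟩ := hmem
    refine ⟨P, ?_⟩
    rw [padicLog_eq_psi X φ₂ hφ₂ P, hP, key, Algebra.smul_def, PadicInt.algebraMap_apply]
    congr 1
    rw [← hu', mul_assoc, Units.mul_inv, mul_one]

end Curve

/-! ## §3 Minimal equations: `log(E(ℚ_p)) = p^{1 + t − v_p c_p − v_p #Ẽ_ns(𝔽_p)} ℤ_p`; ADDITIVE reduction: `#Ẽ_ns(𝔽_p) = p` and `log(E(ℚ_p)) = p^{t − v_p c_p} ℤ_p` -/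

section Minimal

open WeierstrassCurve

variable (X : WeierstrassCurve ℚ_[p]) [X.IsMinimal ℤ_[p]] [X.IsElliptic]

/-- **THE IMAGE OF THE LOGARITHM (minimal equation, any reduction type):**
`log(E(ℚ_p)) = p^{1 + t − v_p c_p − v_p #Ẽ_ns(𝔽_p)} ℤ_p`, `p^t` the `p`-part of `#E(ℚ_p)_tors`,
`c_p = [E(ℚ_p) : E₀(ℚ_p)]` the Tamagawa number, `#Ẽ_ns(𝔽_p)` the number of nonsingular points of
the reduction (with `Õ`) — the `ℤ_p`-dual of Kim's display `exp*_{ω_E} : H¹(ℚ_p,T)/E(ℚ_p) ⊗ ℤ_p ≅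
(#Ẽ_ns(𝔽_p)·[E(ℚ_p):E₀(ℚ_p)])/#H⁰(ℚ_p,E[p^∞]) · (1/p) ℤ_p` under `⟨x,y⟩ = exp*_ω(x)·log_ω(y)`.
[cite: Kim2022StructureSelmer, §3.2.3 (display before Thm. 3.7, PDF p. 16)] [cite: SilvermanAEC2009, IV.6.4, VII.2.1, VII.6.1, VII.6.3] -/
theorem range_padicLog_eq_span_zpow_of_isMinimal :
    (padicLog X).range = (Submodule.span ℤ_[p] {(p : ℚ_[p]) ^
      ((1 : ℤ) + padicValNat p (Nat.card (AddCommGroup.torsion X.toAffine.Point)) -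
        padicValNat p (X.localTamagawaNumber ℤ_[p]) -
        padicValNat p (Nat.card (X.reduction ℤ_[p]).toAffine.Point))}).toAddSubgroup := by
  rw [range_padicLog_eq_span_zpow, padicValNat_index_formalFiltration_two]
  congr 3
  push_cast
  ring

end Minimal

section Additive

open WeierstrassCurve IsLocalRing

variable (X : WeierstrassCurve ℚ_[p]) [hadd : X.HasAdditiveReduction ℤ_[p]] [X.IsElliptic]

/-- **THE LOCAL INDEX AT AN ADDITIVE PRIME, POINTS SIDE: `log(E(ℚ_p)) = p^{t − v_p c_p} ℤ_p`**
(`p^t` the `p`-part of `#E(ℚ_p)_tors`, `c_p` the Tamagawa number), for EVERY prime `p` and with NO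
hypothesis on `E(ℚ_p)[p]` or on `c_p` — the `ℤ_p`-dual of `exp*_{ω_E}(H¹_s(ℚ_p, T)) =
p^{v_p c_p − t} ℤ_p` (Kim, AJM 148, §3.2.3 display with `#Ẽ_ns(𝔽_p) = p`; Kato, Astérisque 295,
proof of Lemma 14.18). Kim's Lemma 3.10 ("additive at `p ≥ 3` ⟹ `exp*_ω(H¹(ℚ_p,T)) = p^{−t}ℤ_p`")
is the case `p ∤ c_p` (`…_of_not_dvd` below); at `p = 3` the Kodaira types IV, IV* have `c₃ = 3`
and the exponent is `t − 1` (cell `b2b-bsdres`, ROUTE-1 §17 F-b: Kim's Remark 3.8 "`p ≤ 3`" is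
a misprint for `p > 3`). [cite: Kim2022StructureSelmer, §3.2.3 (display before Thm. 3.7) and Lemma 3.10 (PDF pp. 16–17)] [cite: SilvermanAEC2009, IV.6.4, VII.6.1, VII.6.3] -/
theorem range_padicLog_eq_span_zpow_of_hasAdditiveReduction :
    (padicLog X).range = (Submodule.span ℤ_[p] {(p : ℚ_[p]) ^
      ((padicValNat p (Nat.card (AddCommGroup.torsion X.toAffine.Point)) : ℤ) -
        padicValNat p (X.localTamagawaNumber ℤ_[p]))}).toAddSubgroup := by
  rw [range_padicLog_eq_span_zpow_of_isMinimal, natCard_point_reduction_of_hasAdditiveReduction,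
    padicValNat.self (Fact.out : p.Prime).one_lt]
  congr 3
  push_cast
  ring

/-- **Kim's Lemma 3.10 regime**: at an additive prime with `p ∤ c_p` (automatic for `p ≥ 5`, where
`c_p ≤ 4`), `log(E(ℚ_p)) = p^t ℤ_p`, dual to `exp*_ω(H¹(ℚ_p, T)/tors) = p^{−t} ℤ_p`.
[cite: Kim2022StructureSelmer, Lemma 3.10 and Remark 3.8 (PDF pp. 16–17)] -/
theorem range_padicLog_eq_span_pow_of_hasAdditiveReduction_of_not_dvd
    (hcp : ¬ p ∣ X.localTamagawaNumber ℤ_[p]) :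
    (padicLog X).range = (Submodule.span ℤ_[p] {(p : ℚ_[p]) ^
      padicValNat p (Nat.card (AddCommGroup.torsion X.toAffine.Point))}).toAddSubgroup := by
  rw [range_padicLog_eq_span_zpow_of_hasAdditiveReduction, padicValNat.eq_zero_of_not_dvd hcp,
    Nat.cast_zero, sub_zero, zpow_natCast]

end Additive

end Summit.BirchSwinnertonDyer.Rank1Residual.Additive.LocalLog

end
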